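/-
Copyright: seat `ym-line-cbag-p2` (prover-ym-line-cbag-p2-g0-0), route `ColdBoxAllGroups`, crux `BulkAllGroups`
(stmt-QuantumFields-22255), line `dlr-chessboard-G` (skeleton `Cruxes/BulkAllGroups/Lines/birth.lean`).
-/
import Summits.QuantumFields.YangMills.Theorems.ColdBoxAllGroupsBulkAllGroupsKernelGoodEventG
import Summits.QuantumFields.YangMills.Theorems.ColdBoxAllGroupsBulkAllGroupsShiftedMeanD
import Summits.QuantumFields.YangMills.Theorems.ColdBoxAllGroupsBulkAllGroupsDlrPlumbingG
import Summits.QuantumFields.YangMills.Theorems.WeakCouplingRatesBulkDominatesColdBoxWKernelMeanCore2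

/-!
# Crux `BulkAllGroups` (stmt-QuantumFields-22255), stub `stub_kernelMeanExpansionG`: the A-mean CORE for every compact gauge group
# (`D` colours, two observable bounds) — G-port of `…BulkDominatesColdBoxWKernelMeanCore2`

`abs_kernelMeanG_sub_gaussian_le_core₂`: for the box kernel `γ(·|ω) = boxKernelG ρ β H ω` of a compact `G` (continuous `ρ`), a likely YM event `E` (`γ(Eᶜ|ω) ≤ pY`), a `D`-colour Gaussian space `D1'^{⊗D}` with a likely event `S` (mass of `Sᶜ` `≤ p ≤ ½`), a bounded
tilt `W` on `S` (`|W| ≤ w`), a measurable chart map `cfg`, and the REPRESENTATION hypothesis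
`E_{γ(·|ω)[|E]}[β c_x] = E_{(D1'^{⊗D}[|S]).tilted W}[β c_x ∘ cfg]` (to be produced by the one-scale representation files of the line), one gets

  `|β·E c_x − ((D/2)C + ½ΣF²)| ≤ 2M₀·pY + M(e^{2w} − 1) + τ + 2(1 + 2DΣ_c(F_c⁴ + 3C²))·√p`,

from `abs_integral_sub_integral_cond_le` (YM side, global bound `M₀`), `abs_mean_tilted_cond_sub_le` (`…MeanBookkeeping`, on-`S` bound `M`),
and the `D`-colour Gaussian bookkeeping `integral_quadObs_sq_piD_le` / `integral_quadObs_piD_eq` (`…BulkAllGroupsShiftedMeanD`).  The YM-side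
rarity `pY = e^{−β^ε}` uniformly over crude-good data is `abs_boxKernelG_integral_sub_cond_le` (`…KernelGoodEventG`).  No new definition;
standard axioms.  NOT a claim about the mass gap; the Yang–Mills mass gap is NOT proved by any of this.
-/

set_option autoImplicit false

noncomputable section

open MeasureTheory ProbabilityTheory Finset
open Literature.Probability.LatticeModels Literature.MathematicalPhysics.QuantumLattice
open Literature.MathematicalPhysics.QuantumFieldTheory
open Summit.QuantumFields.YangMills.Theorems.WeakCouplingRates

namespace Summit.QuantumFields.YangMills.Theorems.ColdBoxAllGroups

variable {N : ℕ} {G : Type*} [Group G] [TopologicalSpace G] [IsTopologicalGroup G] [CompactSpace G]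
  [MeasurableSpace G] [BorelSpace G] [SecondCountableTopology G]
variable (ρ : G →* Matrix (Fin N) (Fin N) ℂ) (hρc : Continuous ρ)
include hρc

/-- **A-mean core, two constants, any compact `G`, `D` colours.**  See the module docstring. [folklore] -/
theorem abs_kernelMeanG_sub_gaussian_le_core₂ {H D : ℕ} {β : ℝ} (ω : LGConfig 4 G)
    (x : Site 4) (i j : Fin 4)
    {E : Set (LGConfig 4 G)} (hE : MeasurableSet E) (hE0 : boxKernelG ρ β H ω E ≠ 0)
    {pY : ℝ} (hpY : (boxKernelG ρ β H ω).real Eᶜ ≤ pY)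
    {M₀ M : ℝ} (hM : 0 ≤ M) (hfM : ∀ U, |β * plaqCostAt ρ x i j U| ≤ M₀)
    (cfg : (Fin D → EuclideanSpace ℝ (DirFree H)) → LGConfig 4 G) (hcfg : Measurable cfg)
    {S : Set (Fin D → EuclideanSpace ℝ (DirFree H))} (hS : MeasurableSet S) (hS0 : (Measure.pi fun _ : Fin D => boxDirichlet H) S ≠ 0)
    {p : ℝ} (hp : (Measure.pi fun _ : Fin D => boxDirichlet H).real Sᶜ ≤ p) (hp2 : p ≤ 1 / 2)
    {W : (Fin D → EuclideanSpace ℝ (DirFree H)) → ℝ} (hWm : Measurable W) {w : ℝ} (hW : ∀ t, |S.indicator W t| ≤ w)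
    (hRep : ∫ U, β * plaqCostAt ρ x i j U ∂((boxKernelG ρ β H ω)[|E]) =
      ∫ t, β * plaqCostAt ρ x i j (cfg t)
        ∂(((Measure.pi fun _ : Fin D => boxDirichlet H)[|S]).tilted (S.indicator W)))
    (F : Fin D → ℝ) (q' : Plaq 4) {τ : ℝ}
    (hFS : ∀ t ∈ S, |β * plaqCostAt ρ x i j (cfg t)| ≤ M)
    (hSur : ∀ t ∈ S, |β * plaqCostAt ρ x i j (cfg t) - (1 / 2 : ℝ) * ∑ c, (F c + dirCirc H q' (t c)) ^ 2| ≤ τ) :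
    |β * (∫ U, plaqCostAt ρ x i j U ∂(boxKernelG ρ β H ω)) -
        ((D : ℝ) / 2 * boxDirProjKernel H q' q' + 1 / 2 * ∑ c, F c ^ 2)| ≤
      2 * M₀ * pY + (M * (Real.exp (2 * w) - 1) + τ +
        2 * (1 + 2 * (D : ℝ) * ∑ c, (F c ^ 4 + 3 * boxDirProjKernel H q' q' ^ 2)) * Real.sqrt p) := by
  haveI : IsProbabilityMeasure (boxKernelG ρ β H ω) := isProbabilityMeasure_boxKernelG ρ hρc β H ω
  set μ := boxKernelG ρ β H ω with hμ
  set γ : Measure (Fin D → EuclideanSpace ℝ (DirFree H)) := Measure.pi fun _ : Fin D => boxDirichlet H with hγ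
  set f : LGConfig 4 G → ℝ := fun U => β * plaqCostAt ρ x i j U with hf
  set Q : (Fin D → EuclideanSpace ℝ (DirFree H)) → ℝ := fun t => (1 / 2 : ℝ) * ∑ c, (F c + dirCirc H q' (t c)) ^ 2 with hQ
  have hfm : Measurable f := measurable_const.mul (measurable_plaqCostAtG ρ hρc x i j)
  have hfi : Integrable f μ := integrable_of_abs_le hfm.aestronglyMeasurable hfM
  have hM₀ : 0 ≤ M₀ := (abs_nonneg _).trans (hfM (fun _ => 1))
  -- (1) YM conditioning
  have h1 : |(∫ U, f U ∂μ) - ∫ U, f U ∂(μ[|E])| ≤ 2 * M₀ * pY := by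
    have key := abs_integral_sub_integral_cond_le (μ := μ) hE hE0 hfi hfM
    have h2 : 0 ≤ 2 * M₀ := by linarith
    exact key.trans (mul_le_mul_of_nonneg_left hpY h2)
  -- (2)+(3) representation and mean bookkeeping on the Gaussian side
  have hQ2 : MemLp Q 2 γ := memLp_two_quadObs_piD F q'
  have hFm : Measurable fun t => f (cfg t) := hfm.comp hcfg
  have h3 := abs_mean_tilted_cond_sub_le (γ := γ) hS hS0 hWm hW (F := fun t => f (cfg t)) (Q := Q) hFm hQ2 hM hFS hSur hp hp2
  have hQsq : ∫ t, Q t ^ 2 ∂γ ≤ 2 * (D : ℝ) * ∑ c, (F c ^ 4 + 3 * boxDirProjKernel H q' q' ^ 2) := integral_quadObs_sq_piD_le (H := H) F q'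
  have hsqrt0 : 0 ≤ Real.sqrt p := Real.sqrt_nonneg _
  have h3' : |(∫ t, f (cfg t) ∂((γ[|S]).tilted (S.indicator W))) - ∫ t, Q t ∂γ| ≤
      M * (Real.exp (2 * w) - 1) + τ + 2 * (1 + 2 * (D : ℝ) * ∑ c, (F c ^ 4 + 3 * boxDirProjKernel H q' q' ^ 2)) * Real.sqrt p := by
    refine h3.trans ?_
    have : 2 * (1 + ∫ t, Q t ^ 2 ∂γ) * Real.sqrt p ≤ 2 * (1 + 2 * (D : ℝ) * ∑ c, (F c ^ 4 + 3 * boxDirProjKernel H q' q' ^ 2)) * Real.sqrt p := by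
      apply mul_le_mul_of_nonneg_right _ hsqrt0
      linarith
    linarith
  -- (4) the exact Gaussian value
  have h4 : ∫ t, Q t ∂γ = (D : ℝ) / 2 * boxDirProjKernel H q' q' + 1 / 2 * ∑ c, F c ^ 2 := integral_quadObs_piD_eq F q'
  -- assemble
  have e0 : β * (∫ U, plaqCostAt ρ x i j U ∂μ) = ∫ U, f U ∂μ := by
    rw [hf, integral_const_mul]
  rw [e0, ← h4]
  have hrep' : ∫ U, f U ∂(μ[|E]) = ∫ t, f (cfg t) ∂((γ[|S]).tilted (S.indicator W)) := hRep
  rw [hrep'] at h1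
  calc |(∫ U, f U ∂μ) - ∫ t, Q t ∂γ|
      ≤ |(∫ U, f U ∂μ) - ∫ t, f (cfg t) ∂((γ[|S]).tilted (S.indicator W))| +
          |(∫ t, f (cfg t) ∂((γ[|S]).tilted (S.indicator W))) - ∫ t, Q t ∂γ| := abs_sub_le _ _ _
    _ ≤ _ := add_le_add h1 h3'

end Summit.QuantumFields.YangMills.Theorems.ColdBoxAllGroups

end
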